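import Summits.BirchSwinnertonDyer.BirchSwinnertonDyer.Theorems.KatoDescentPotSupersingularWildConjAResidueUnitIndexRows01
import Literature.NumberTheory.EllipticCurves.FineSelmerLimThm35Proofs
import Literature.NumberTheory.EllipticCurves.FineSelmerClassGroupCriterionThm34Proofs
import Literature.NumberTheory.IwasawaTheory.Fukuda1994Thm1Proofs
import Literature.NumberTheory.IwasawaTheory.Fukuda1994Thm1RankProofs
import HarnessLib

/-!
# NoF RE-ISSUE (seat `bsd-potss-k9-c4` g25, 2026-08-29; `--supports stmt-BirchSwinnertonDyer-19197 --as helper`) of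
# `KatoDescentPotSupersingularWildConjAResidueUnitIndexRows01.lean`:
# the SAME per-row theorems with the μ-road named facts that are now TREE THEOREMS no longer displayed as hypotheses —
# `hLim` (Lim 2017 Thm. 3.5) := `Lim2017.thm35_fineSelmerDual_moduleFinite_of_classicalMuVanishes_of_le_divisionField_holds` (rkm g34, p695193),
# `hF1` (Fukuda 1994 Thm. 1 (1)) := `IwasawaTheory.fukuda1994_thm1_classNumberPExp_const_of_succ_eq_holds` (k8t-c4 g20),
# `hF2` (Fukuda 1994 Thm. 1 (2)) := `IwasawaTheory.fukuda1994_thm1_classGroupPRank_const_of_succ_eq_holds` (k8t-c4 g20, p681350),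
# `hCS` (Coates–Sujatha 2005 Thm. 3.4) := `CoatesSujatha2005.thm34_fineSelmerDual_moduleFinite_of_classicalMuVanishes_divisionField_holds` (k8t-c4 g22, p694085).

HONEST FRAMING. THEOREMS ONLY; PER ROW; nothing booked; items 19189 / 19197 / 19942 stay OPEN at class level (open input of record: the zeta crux 24327);
(A) / Conjecture A / BSD proved for NO class of curves.  Every theorem below is the original record (same name + suffix `NoF`, same displayed NUMERIC
hypotheses, same kernel certificates, same proof term) with the discharged fact binders deleted and the `_holds` theorems substituted in the proof; the
remaining displayed named facts are exactly those the original displays minus {hLim, hF1, hF2, hCS} (for the `GL₂(𝔽₃)` `L_P`-road records: NONE beyond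
`hKatoA hGZK hmod` on the U₀ twin — statement (A) at `(E,3)` becomes a kernel theorem modulo the displayed numerics of `L_P` alone; for the Cartan
unit-index / Fukuda records: Ferrero–Washington `hFW` only).  Row section headers, numerics, evidence pointers and citations are those of the original
file VERBATIM (its module docstring is reproduced below under «ORIGINAL HEADER»); the per-theorem docstrings are the originals prefixed with the NoF marker.

ORIGINAL HEADER of `KatoDescentPotSupersingularWildConjAResidueUnitIndexRows01`:

> # Route `KatoDescentPotSupersingular` (rung K9, sub-rung B5 = O6 wild `p = 3`, cell `bsd-potss`): five RESIDUE ROWS of the Conj-A crux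
> # `WildCoatesSujathaResidue` (19942; U₀-ns node 19189 → parent 19197 `WildUpperDefectRankZero`) — (A) / U₀ per row with the classical
> # `μ`-hypothesis DISCHARGED modulo named facts by the UNIT NORM-INDEX door (Chevalley ∘ Fukuda) or by FUKUDA (0,1), from displayed numerics
> # about ONE explicit number field per row (seat `bsd-potss-k9-c4` g19; `--supports stmt-BirchSwinnertonDyer-19197 --as helper`)
> 
> HONEST FRAMING. THEOREMS ONLY (no definition, no named fact, no `sorry`); PER ROW — NOT a class theorem; nothing is booked; items 19942 / 19189
> / 19197 stay OPEN at class level (open input: the zeta crux 24327 `WildKatoZetaIndivisible`); Coates–Sujatha's (A), Conjecture A and BSD are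
> proved for NO curve here.  Predecessor records (this seat g18, `…WildConjAResidueCartanRows01–12`, `…NnIw01–03`): on the 11 `3Ns` residue rows
> U₀ was recorded from named facts + `r_an = 0` + ONE DISPLAYED classical hypothesis `hμ` («`μ = 0` for the cyclotomic `ℤ_3`-extension of the
> maximal real subfield `K⁺ = ℚ(E[3])⁺`», a quartic with ≥ 2 primes above `3` — no Iwasawa-1956 door); the two `GL₂(𝔽₃)`-image residue rows
> 388800ho1/ii1 had NO Cartan road.  THIS FILE replaces `hμ` by NUMERICS CERTIFIED BY PARI/GP (kit j308542, `--workitem 19197`; engine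
> `unitidx3.gp` = conjA-anchor g12's `unitidx.gp` at `p = 3` with an EXACT total-ramification test `v ∣ rnfdisc(K, x³−3x+1)`):
> * rows 100386bx1, 155142bf1, 483678bi1 (`3Ns`): `K⁺ = ℚ[x]/(x⁴ − x³ + 2x² − 9x + 3)` (disc `−6591`): `h = 1` (bnfcertify: CERTIFIED), primes
>   above `3`: two (`[e,f] = [2,1], [1,2]`), both ramified in `K⁺·ℚ(ζ₉)⁺/K⁺` (Fukuda index `0`), local norm symbols of {`−1`, ε₁, ε₂} at the two
>   primes `= [0,0; 2,1; 0,0]` (rank `1 = s − 1`) ⟹ unit norm index `3 = 3^{s−1}` ⟹ door `…_of_realUnitIndex` (this seat's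
>   `UnitIndexMuDoors`, over conjA-anchor g12's p627068): GRH-FREE inputs;
> * row 272214x1 (`3Ns`): `K⁺ = ℚ[x]/(x⁴ − x³ − 44x² − 111x − 33)`: `h = 3` (door shut) but `e₀ = e₁ = 1` (`K⁺₁ = K⁺·ℚ(ζ₉)⁺` of degree 12 has
>   `h = 12`, GRH at layer 1), Fukuda index `0` ⟹ door `…_of_realSuccEq` (Fukuda 1994 Thm. 1 (1));
> * row 388800ii1 (`GL₂(𝔽₃)` image, 9-deficient; no Cartan road): on `L_P = ℚ(E[3])^{U_P}` (conjA-anchor g9's `unipotentStabilizerField`; `=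
>   ℚ(P, ζ₃)`, degree 16 = 48/3, `x¹⁶ − …` below): `h(L_P) = 2` (CERTIFIED at degree 16), primes above `3`: two (`[2,2], [6,2]`), both ramified
>   in the first cyclotomic layer (exact test; the crude test `3 ∤ e·f` fails at `[6,2]`), unit symbol rank `1` ⟹ door
>   `…_of_relIndex_mul_eq_unipotentStabilizerField` (Lim 2017 Thm. 3.5 ∘ unit norm index) — the FIRST U₀ record on this row, GRH-free;
>   conjA-anchor g9's census (j296187) had it FUKUDA1-LP(0,1) under GRH at layer 1. (388800ho1: `L_P` symbol rank `2 < 3`, `e₀ = 0 → e₁ = 1`;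
>   of its three octic subfields `ℚ(P)` GROWS — undecided, no record.)
> DISPLAYED per row: the named facts; Cremona's `r_an = 0`; the carrier field (`Kp` with `hKp : Kp = ℚ(E[3])^c`, `c` a complex conjugation — resp.
> `P ∈ E[3]` for `L_P`; the numerics are those of `P ≠ 0`) and its numerics (`hh`, `hs`, `hram`, `hidx` / `hord`).  KERNEL per row (g18, imported):
> `Δ ≠ 0`, minimality, `E[3]` irreducible, `ClassO6 E 3`, the `3Ns` image.  Data/generators: HOME/k9-c4/g19/.
> 
> References: [Lang1990] Ch. 13 §4 Lemma 4.1; [Fukuda1994] Thm. 1 (1); [Lim2017FineSelmer] §3 Thm. 3.5; [CoatesSujatha2005] Thm. 3.4;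
> [Kato2004Asterisque] Thm. 14.5 (3); [Serre1972] §2.2, §5.2; [Cremona2006] Table 1.
> 
-/

set_option autoImplicit false
set_option linter.dupNamespace false

noncomputable section

open scoped Classical NumberField
open WeierstrassCurve NumberField IsDedekindDomain Field IntermediateField
  Literature.NumberTheory.EllipticCurves Literature.NumberTheory.EllipticCurves.Rank1Residual
  Literature.NumberTheory.EllipticCurves.Rank1Residual.Typed
  Literature.NumberTheory.GaloisRepresentations Literature.NumberTheory.SerreUniformity Literature.NumberTheory.IwasawaTheory
  Literature.NumberTheory.GaloisRepresentations.Herbrand Literature.NumberTheory.GaloisRepresentations.MinkowskiUnit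
  Literature.NumberTheory.GaloisRepresentations.CyclicNormIndex
  Summit.BirchSwinnertonDyer.Rank1Residual Summit.BirchSwinnertonDyer.Rank1Residual.Additive
  Summit.BirchSwinnertonDyer.BirchSwinnertonDyer.Theorems

namespace Summit.BirchSwinnertonDyer.BirchSwinnertonDyer.Theorems.WildUpperUnitTwistRecords

/-! ### `100386bx1` @ `p = 3` (`3Ns`; `K⁺ = ℚ[x]/(x⁴ − x³ + 2x² − 9x + 3)`, `h = 1` CERT, primes `[2,1],[1,2]`, symbols `[0,0;2,1;0,0]`: PASS UNIT `s = 2`) -/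

set_option synthInstance.maxHeartbeats 400000 in
set_option maxHeartbeats 4000000 in
/-- **[NoF re-issue: the named facts `hLim`/`hF1`/`hF2`/`hCS` displayed by the original are DISCHARGED here by the tree theorems `…_holds` — read «modulo hLim/hF1/hF2/hCS» below as «no longer assumed».]** **(A) AT `(100386bx1, 3)` with `hμ` DISCHARGED by the UNIT NORM-INDEX door** (modulo the named facts Coates–Sujatha Thm. 3.4 `hCS`,
Ferrero–Washington `hFW`, Fukuda Thm. 1 (1) `hF1`): `c` a complex conjugation, `Kp = ℚ(E[3])^c` its fixed field (`hKp`; `≅ ℚ[x]/(x⁴−x³+2x²−9x+3)`),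
and the PARI-certified numerics of that quartic: `3 ∤ h(Kp) = 1` (`hh`), two primes above `3` (`hs`), Fukuda index `0` (`hram`), unit norm index
`3` from the first layer (`hidx`). KERNEL: the `3Ns` image (g18). CONDITIONAL; nothing booked; (A)/BSD proved for no curve.
[cite: Lang1990, Ch. 13 §4, Lemma 4.1 (PDF p. 203)] [cite: CoatesSujatha2005, Thm. 3.4 (§3)] [cite: Cremona2006, Table 1 (Cremona label 100386bx1)] -/
theorem conjA_g100386bx1_3_uiNoF
    (hFW : ferreroWashington1979_classicalMuVanishes)
    {W : WeierstrassCurve ℚ} [W.IsElliptic] (hWeq : W = (⟨1, (-1), 1, (-44336), (-3583277)⟩ : WeierstrassCurve ℚ))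
    {c : absoluteGaloisGroup ℚ} (hc : IsComplexConjugation (Rat.castHom ℝ) c)
    (Kp : IntermediateField ℚ ↥(W.divisionField 3)) (hKp : Kp = fixedField (Subgroup.zpowers (absRestrictNormalHom (W.divisionField 3) c)))
    (hh : haveI : NumberField ↥(W.divisionField 3) := NumberField.mk
      ¬ 3 ∣ NumberField.classNumber ↥Kp)
    (hs : {v : HeightOneSpectrum (𝓞 ↥Kp) | ((3 : ℕ) : 𝓞 ↥Kp) ∈ v.asIdeal}.ncard = 2)
    (hram : ∀ κE : ZpExtension ↥Kp 3, κE.IsCyclotomic → TotallyRamifiedFrom κE 0)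
    (hidx : haveI : NumberField ↥(W.divisionField 3) := NumberField.mk
      ∀ κE : ZpExtension ↥Kp 3, κE.IsCyclotomic →
      haveI : FiniteDimensional ↥Kp (κE.layer 1) := κE.finiteDimensional_layer_holds 1
      (unitsE (κE.layer 1) ⊓ (⊤ : Subgroup (κE.layer 1)ˣ).map (Herbrand.norm (κE.layer 1 ≃ₐ[↥Kp] κE.layer 1))).relIndex
        (unitsE (κE.layer 1) ⊓ (unitsIncl ↥Kp (κE.layer 1)).range) * 3 = 3 ^ 2)
    (κ : ZpExtension ℚ 3) (hκ : κ.IsCyclotomic) :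
    ∃ (γ : absoluteGaloisGroup ℚ) (Df : W.FineSelmerDualData κ γ),
      Module.Finite ℤ_[3] (RestrictScalars ℤ_[3] (IwasawaAlgebra 3) Df.X) := by
  subst hWeq
  exact UnitIndexMuDoors.conjA_three_of_hasSplitCartanNormalizerModPImage_of_realUnitIndex _ CoatesSujatha2005.thm34_fineSelmerDual_moduleFinite_of_classicalMuVanishes_divisionField_holds hFW fukuda1994_thm1_classNumberPExp_const_of_succ_eq_holds
    hasSplitCartanNormalizerModPImage_g100386bx1_3 hc Kp hKp hh hs hram hidx κ hκ

set_option synthInstance.maxHeartbeats 400000 in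
set_option maxHeartbeats 4000000 in
/-- **[NoF re-issue: the named facts `hLim`/`hF1`/`hF2`/`hCS` displayed by the original are DISCHARGED here by the tree theorems `…_holds` — read «modulo hLim/hF1/hF2/hCS» below as «no longer assumed».]** **RECORD — U₀ `ord₃ #Ш(E) ≤ ord₃ #Ш_an(E)` for `E = 100386bx1` with `hμ` DISCHARGED by the UNIT NORM-INDEX door**: from the named facts
{A161-fine `hKatoA`, GZK `hGZK`, modularity `hmod`, `hCS`, `hFW`, Fukuda `hF1`}, Cremona's `r_an = 0` (`hr`), and the PARI-certified numerics
`hh`/`hs`/`hram`/`hidx` of the quartic `Kp = ℚ(E[3])^c ≅ ℚ[x]/(x⁴−x³+2x²−9x+3)` (kit j308542: `h = 1` CERT, `s = 2`, symbol rank `1`). KERNEL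
(g18): `E` elliptic, minimal, `ClassO6 E 3`, `E[3]` irreducible, `3Ns` image. Supersedes the displayed-`hμ` record `missingUpperBoundAt_g100386bx1_3`.
Per row; nothing booked; BSD proved for no curve. [cite: Kato2004Asterisque, Thm. 14.5 (3) (p. 236)] [cite: Lang1990, Ch. 13 §4, Lemma 4.1 (PDF p. 203)]
[cite: Fukuda1994, Thm. 1 (1), p. 264] [cite: Cremona2006, Table 1 (Cremona label 100386bx1)] -/
theorem missingUpperBoundAt_g100386bx1_3_uiNoF
    (hKatoA : Kato2004.rankZero_padicValNat_sha_add_padicValNat_tamagawa_le_of_additive_potGood_of_irreducible_of_fineSelmerDual_fg)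
    (hGZK : rank_eq_analyticRank_of_analyticRank_le_one) (hmod : hasEntireLFunction_rat)
    (hFW : ferreroWashington1979_classicalMuVanishes)
    {W : WeierstrassCurve ℚ} [W.IsElliptic] [W.IsGloballyMinimal] (hWeq : W = (⟨1, (-1), 1, (-44336), (-3583277)⟩ : WeierstrassCurve ℚ)) (hr : W.analyticRank = 0)
    {c : absoluteGaloisGroup ℚ} (hc : IsComplexConjugation (Rat.castHom ℝ) c)
    (Kp : IntermediateField ℚ ↥(W.divisionField 3)) (hKp : Kp = fixedField (Subgroup.zpowers (absRestrictNormalHom (W.divisionField 3) c)))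
    (hh : haveI : NumberField ↥(W.divisionField 3) := NumberField.mk
      ¬ 3 ∣ NumberField.classNumber ↥Kp)
    (hs : {v : HeightOneSpectrum (𝓞 ↥Kp) | ((3 : ℕ) : 𝓞 ↥Kp) ∈ v.asIdeal}.ncard = 2)
    (hram : ∀ κE : ZpExtension ↥Kp 3, κE.IsCyclotomic → TotallyRamifiedFrom κE 0)
    (hidx : haveI : NumberField ↥(W.divisionField 3) := NumberField.mk
      ∀ κE : ZpExtension ↥Kp 3, κE.IsCyclotomic →
      haveI : FiniteDimensional ↥Kp (κE.layer 1) := κE.finiteDimensional_layer_holds 1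
      (unitsE (κE.layer 1) ⊓ (⊤ : Subgroup (κE.layer 1)ˣ).map (Herbrand.norm (κE.layer 1 ≃ₐ[↥Kp] κE.layer 1))).relIndex
        (unitsE (κE.layer 1) ⊓ (unitsIncl ↥Kp (κE.layer 1)).range) * 3 = 3 ^ 2) :
    MissingUpperBoundAt W 3 := by
  subst hWeq
  haveI : Fact (Nat.Prime 3) := ⟨Nat.prime_three⟩
  exact UnitIndexMuDoors.missingUpperBoundAt_three_of_hasSplitCartanNormalizerModPImage_of_realUnitIndex _ hKatoA hGZK hmod CoatesSujatha2005.thm34_fineSelmerDual_moduleFinite_of_classicalMuVanishes_divisionField_holds hFW fukuda1994_thm1_classNumberPExp_const_of_succ_eq_holds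
    hr classO6_g100386bx1_3 irr_g100386bx1_3 hasSplitCartanNormalizerModPImage_g100386bx1_3 hc Kp hKp hh hs hram hidx

/-! ### `155142bf1` @ `p = 3` (`3Ns`; `K⁺ = ℚ[x]/(x⁴ − x³ + 2x² − 9x + 3)`, `h = 1` CERT, primes `[2,1],[1,2]`, symbols `[0,0;2,1;0,0]`: PASS UNIT `s = 2`) -/

set_option synthInstance.maxHeartbeats 400000 in
set_option maxHeartbeats 4000000 in
/-- **[NoF re-issue: the named facts `hLim`/`hF1`/`hF2`/`hCS` displayed by the original are DISCHARGED here by the tree theorems `…_holds` — read «modulo hLim/hF1/hF2/hCS» below as «no longer assumed».]** **(A) AT `(155142bf1, 3)` with `hμ` DISCHARGED by the UNIT NORM-INDEX door** (modulo the named facts Coates–Sujatha Thm. 3.4 `hCS`,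
Ferrero–Washington `hFW`, Fukuda Thm. 1 (1) `hF1`): `c` a complex conjugation, `Kp = ℚ(E[3])^c` its fixed field (`hKp`; `≅ ℚ[x]/(x⁴−x³+2x²−9x+3)`),
and the PARI-certified numerics of that quartic: `3 ∤ h(Kp) = 1` (`hh`), two primes above `3` (`hs`), Fukuda index `0` (`hram`), unit norm index
`3` from the first layer (`hidx`). KERNEL: the `3Ns` image (g18). CONDITIONAL; nothing booked; (A)/BSD proved for no curve.
[cite: Lang1990, Ch. 13 §4, Lemma 4.1 (PDF p. 203)] [cite: CoatesSujatha2005, Thm. 3.4 (§3)] [cite: Cremona2006, Table 1 (Cremona label 155142bf1)] -/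
theorem conjA_g155142bf1_3_uiNoF
    (hFW : ferreroWashington1979_classicalMuVanishes)
    {W : WeierstrassCurve ℚ} [W.IsElliptic] (hWeq : W = (⟨1, (-1), 1, 1968649, (-292154417)⟩ : WeierstrassCurve ℚ))
    {c : absoluteGaloisGroup ℚ} (hc : IsComplexConjugation (Rat.castHom ℝ) c)
    (Kp : IntermediateField ℚ ↥(W.divisionField 3)) (hKp : Kp = fixedField (Subgroup.zpowers (absRestrictNormalHom (W.divisionField 3) c)))
    (hh : haveI : NumberField ↥(W.divisionField 3) := NumberField.mk
      ¬ 3 ∣ NumberField.classNumber ↥Kp)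
    (hs : {v : HeightOneSpectrum (𝓞 ↥Kp) | ((3 : ℕ) : 𝓞 ↥Kp) ∈ v.asIdeal}.ncard = 2)
    (hram : ∀ κE : ZpExtension ↥Kp 3, κE.IsCyclotomic → TotallyRamifiedFrom κE 0)
    (hidx : haveI : NumberField ↥(W.divisionField 3) := NumberField.mk
      ∀ κE : ZpExtension ↥Kp 3, κE.IsCyclotomic →
      haveI : FiniteDimensional ↥Kp (κE.layer 1) := κE.finiteDimensional_layer_holds 1
      (unitsE (κE.layer 1) ⊓ (⊤ : Subgroup (κE.layer 1)ˣ).map (Herbrand.norm (κE.layer 1 ≃ₐ[↥Kp] κE.layer 1))).relIndex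
        (unitsE (κE.layer 1) ⊓ (unitsIncl ↥Kp (κE.layer 1)).range) * 3 = 3 ^ 2)
    (κ : ZpExtension ℚ 3) (hκ : κ.IsCyclotomic) :
    ∃ (γ : absoluteGaloisGroup ℚ) (Df : W.FineSelmerDualData κ γ),
      Module.Finite ℤ_[3] (RestrictScalars ℤ_[3] (IwasawaAlgebra 3) Df.X) := by
  subst hWeq
  exact UnitIndexMuDoors.conjA_three_of_hasSplitCartanNormalizerModPImage_of_realUnitIndex _ CoatesSujatha2005.thm34_fineSelmerDual_moduleFinite_of_classicalMuVanishes_divisionField_holds hFW fukuda1994_thm1_classNumberPExp_const_of_succ_eq_holds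
    hasSplitCartanNormalizerModPImage_g155142bf1_3 hc Kp hKp hh hs hram hidx κ hκ

set_option synthInstance.maxHeartbeats 400000 in
set_option maxHeartbeats 4000000 in
/-- **[NoF re-issue: the named facts `hLim`/`hF1`/`hF2`/`hCS` displayed by the original are DISCHARGED here by the tree theorems `…_holds` — read «modulo hLim/hF1/hF2/hCS» below as «no longer assumed».]** **RECORD — U₀ `ord₃ #Ш(E) ≤ ord₃ #Ш_an(E)` for `E = 155142bf1` with `hμ` DISCHARGED by the UNIT NORM-INDEX door**: from the named facts
{A161-fine `hKatoA`, GZK `hGZK`, modularity `hmod`, `hCS`, `hFW`, Fukuda `hF1`}, Cremona's `r_an = 0` (`hr`), and the PARI-certified numerics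
`hh`/`hs`/`hram`/`hidx` of the quartic `Kp = ℚ(E[3])^c ≅ ℚ[x]/(x⁴−x³+2x²−9x+3)` (kit j308542: `h = 1` CERT, `s = 2`, symbol rank `1`). KERNEL
(g18): `E` elliptic, minimal, `ClassO6 E 3`, `E[3]` irreducible, `3Ns` image. Supersedes the displayed-`hμ` record `missingUpperBoundAt_g155142bf1_3`.
Per row; nothing booked; BSD proved for no curve. [cite: Kato2004Asterisque, Thm. 14.5 (3) (p. 236)] [cite: Lang1990, Ch. 13 §4, Lemma 4.1 (PDF p. 203)]
[cite: Fukuda1994, Thm. 1 (1), p. 264] [cite: Cremona2006, Table 1 (Cremona label 155142bf1)] -/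
theorem missingUpperBoundAt_g155142bf1_3_uiNoF
    (hKatoA : Kato2004.rankZero_padicValNat_sha_add_padicValNat_tamagawa_le_of_additive_potGood_of_irreducible_of_fineSelmerDual_fg)
    (hGZK : rank_eq_analyticRank_of_analyticRank_le_one) (hmod : hasEntireLFunction_rat)
    (hFW : ferreroWashington1979_classicalMuVanishes)
    {W : WeierstrassCurve ℚ} [W.IsElliptic] [W.IsGloballyMinimal] (hWeq : W = (⟨1, (-1), 1, 1968649, (-292154417)⟩ : WeierstrassCurve ℚ)) (hr : W.analyticRank = 0)
    {c : absoluteGaloisGroup ℚ} (hc : IsComplexConjugation (Rat.castHom ℝ) c)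
    (Kp : IntermediateField ℚ ↥(W.divisionField 3)) (hKp : Kp = fixedField (Subgroup.zpowers (absRestrictNormalHom (W.divisionField 3) c)))
    (hh : haveI : NumberField ↥(W.divisionField 3) := NumberField.mk
      ¬ 3 ∣ NumberField.classNumber ↥Kp)
    (hs : {v : HeightOneSpectrum (𝓞 ↥Kp) | ((3 : ℕ) : 𝓞 ↥Kp) ∈ v.asIdeal}.ncard = 2)
    (hram : ∀ κE : ZpExtension ↥Kp 3, κE.IsCyclotomic → TotallyRamifiedFrom κE 0)
    (hidx : haveI : NumberField ↥(W.divisionField 3) := NumberField.mk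
      ∀ κE : ZpExtension ↥Kp 3, κE.IsCyclotomic →
      haveI : FiniteDimensional ↥Kp (κE.layer 1) := κE.finiteDimensional_layer_holds 1
      (unitsE (κE.layer 1) ⊓ (⊤ : Subgroup (κE.layer 1)ˣ).map (Herbrand.norm (κE.layer 1 ≃ₐ[↥Kp] κE.layer 1))).relIndex
        (unitsE (κE.layer 1) ⊓ (unitsIncl ↥Kp (κE.layer 1)).range) * 3 = 3 ^ 2) :
    MissingUpperBoundAt W 3 := by
  subst hWeq
  haveI : Fact (Nat.Prime 3) := ⟨Nat.prime_three⟩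
  exact UnitIndexMuDoors.missingUpperBoundAt_three_of_hasSplitCartanNormalizerModPImage_of_realUnitIndex _ hKatoA hGZK hmod CoatesSujatha2005.thm34_fineSelmerDual_moduleFinite_of_classicalMuVanishes_divisionField_holds hFW fukuda1994_thm1_classNumberPExp_const_of_succ_eq_holds
    hr classO6_g155142bf1_3 irr_g155142bf1_3 hasSplitCartanNormalizerModPImage_g155142bf1_3 hc Kp hKp hh hs hram hidx

/-! ### `483678bi1` @ `p = 3` (`3Ns`; `K⁺ = ℚ[x]/(x⁴ − x³ + 2x² − 9x + 3)`, `h = 1` CERT, primes `[2,1],[1,2]`, symbols `[0,0;2,1;0,0]`: PASS UNIT `s = 2`) -/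

set_option synthInstance.maxHeartbeats 400000 in
set_option maxHeartbeats 4000000 in
/-- **[NoF re-issue: the named facts `hLim`/`hF1`/`hF2`/`hCS` displayed by the original are DISCHARGED here by the tree theorems `…_holds` — read «modulo hLim/hF1/hF2/hCS» below as «no longer assumed».]** **(A) AT `(483678bi1, 3)` with `hμ` DISCHARGED by the UNIT NORM-INDEX door** (modulo the named facts Coates–Sujatha Thm. 3.4 `hCS`,
Ferrero–Washington `hFW`, Fukuda Thm. 1 (1) `hF1`): `c` a complex conjugation, `Kp = ℚ(E[3])^c` its fixed field (`hKp`; `≅ ℚ[x]/(x⁴−x³+2x²−9x+3)`),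
and the PARI-certified numerics of that quartic: `3 ∤ h(Kp) = 1` (`hh`), two primes above `3` (`hs`), Fukuda index `0` (`hram`), unit norm index
`3` from the first layer (`hidx`). KERNEL: the `3Ns` image (g18). CONDITIONAL; nothing booked; (A)/BSD proved for no curve.
[cite: Lang1990, Ch. 13 §4, Lemma 4.1 (PDF p. 203)] [cite: CoatesSujatha2005, Thm. 3.4 (§3)] [cite: Cremona2006, Table 1 (Cremona label 483678bi1)] -/
theorem conjA_g483678bi1_3_uiNoF
    (hFW : ferreroWashington1979_classicalMuVanishes)
    {W : WeierstrassCurve ℚ} [W.IsElliptic] (hWeq : W = (⟨1, (-1), 1, (-126872219), (-561922662453)⟩ : WeierstrassCurve ℚ))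
    {c : absoluteGaloisGroup ℚ} (hc : IsComplexConjugation (Rat.castHom ℝ) c)
    (Kp : IntermediateField ℚ ↥(W.divisionField 3)) (hKp : Kp = fixedField (Subgroup.zpowers (absRestrictNormalHom (W.divisionField 3) c)))
    (hh : haveI : NumberField ↥(W.divisionField 3) := NumberField.mk
      ¬ 3 ∣ NumberField.classNumber ↥Kp)
    (hs : {v : HeightOneSpectrum (𝓞 ↥Kp) | ((3 : ℕ) : 𝓞 ↥Kp) ∈ v.asIdeal}.ncard = 2)
    (hram : ∀ κE : ZpExtension ↥Kp 3, κE.IsCyclotomic → TotallyRamifiedFrom κE 0)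
    (hidx : haveI : NumberField ↥(W.divisionField 3) := NumberField.mk
      ∀ κE : ZpExtension ↥Kp 3, κE.IsCyclotomic →
      haveI : FiniteDimensional ↥Kp (κE.layer 1) := κE.finiteDimensional_layer_holds 1
      (unitsE (κE.layer 1) ⊓ (⊤ : Subgroup (κE.layer 1)ˣ).map (Herbrand.norm (κE.layer 1 ≃ₐ[↥Kp] κE.layer 1))).relIndex
        (unitsE (κE.layer 1) ⊓ (unitsIncl ↥Kp (κE.layer 1)).range) * 3 = 3 ^ 2)
    (κ : ZpExtension ℚ 3) (hκ : κ.IsCyclotomic) :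
    ∃ (γ : absoluteGaloisGroup ℚ) (Df : W.FineSelmerDualData κ γ),
      Module.Finite ℤ_[3] (RestrictScalars ℤ_[3] (IwasawaAlgebra 3) Df.X) := by
  subst hWeq
  exact UnitIndexMuDoors.conjA_three_of_hasSplitCartanNormalizerModPImage_of_realUnitIndex _ CoatesSujatha2005.thm34_fineSelmerDual_moduleFinite_of_classicalMuVanishes_divisionField_holds hFW fukuda1994_thm1_classNumberPExp_const_of_succ_eq_holds
    hasSplitCartanNormalizerModPImage_g483678bi1_3 hc Kp hKp hh hs hram hidx κ hκ

set_option synthInstance.maxHeartbeats 400000 in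
set_option maxHeartbeats 4000000 in
/-- **[NoF re-issue: the named facts `hLim`/`hF1`/`hF2`/`hCS` displayed by the original are DISCHARGED here by the tree theorems `…_holds` — read «modulo hLim/hF1/hF2/hCS» below as «no longer assumed».]** **RECORD — U₀ `ord₃ #Ш(E) ≤ ord₃ #Ш_an(E)` for `E = 483678bi1` with `hμ` DISCHARGED by the UNIT NORM-INDEX door**: from the named facts
{A161-fine `hKatoA`, GZK `hGZK`, modularity `hmod`, `hCS`, `hFW`, Fukuda `hF1`}, Cremona's `r_an = 0` (`hr`), and the PARI-certified numerics
`hh`/`hs`/`hram`/`hidx` of the quartic `Kp = ℚ(E[3])^c ≅ ℚ[x]/(x⁴−x³+2x²−9x+3)` (kit j308542: `h = 1` CERT, `s = 2`, symbol rank `1`). KERNEL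
(g18): `E` elliptic, minimal, `ClassO6 E 3`, `E[3]` irreducible, `3Ns` image. Supersedes the displayed-`hμ` record `missingUpperBoundAt_g483678bi1_3`.
Per row; nothing booked; BSD proved for no curve. [cite: Kato2004Asterisque, Thm. 14.5 (3) (p. 236)] [cite: Lang1990, Ch. 13 §4, Lemma 4.1 (PDF p. 203)]
[cite: Fukuda1994, Thm. 1 (1), p. 264] [cite: Cremona2006, Table 1 (Cremona label 483678bi1)] -/
theorem missingUpperBoundAt_g483678bi1_3_uiNoF
    (hKatoA : Kato2004.rankZero_padicValNat_sha_add_padicValNat_tamagawa_le_of_additive_potGood_of_irreducible_of_fineSelmerDual_fg)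
    (hGZK : rank_eq_analyticRank_of_analyticRank_le_one) (hmod : hasEntireLFunction_rat)
    (hFW : ferreroWashington1979_classicalMuVanishes)
    {W : WeierstrassCurve ℚ} [W.IsElliptic] [W.IsGloballyMinimal] (hWeq : W = (⟨1, (-1), 1, (-126872219), (-561922662453)⟩ : WeierstrassCurve ℚ)) (hr : W.analyticRank = 0)
    {c : absoluteGaloisGroup ℚ} (hc : IsComplexConjugation (Rat.castHom ℝ) c)
    (Kp : IntermediateField ℚ ↥(W.divisionField 3)) (hKp : Kp = fixedField (Subgroup.zpowers (absRestrictNormalHom (W.divisionField 3) c)))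
    (hh : haveI : NumberField ↥(W.divisionField 3) := NumberField.mk
      ¬ 3 ∣ NumberField.classNumber ↥Kp)
    (hs : {v : HeightOneSpectrum (𝓞 ↥Kp) | ((3 : ℕ) : 𝓞 ↥Kp) ∈ v.asIdeal}.ncard = 2)
    (hram : ∀ κE : ZpExtension ↥Kp 3, κE.IsCyclotomic → TotallyRamifiedFrom κE 0)
    (hidx : haveI : NumberField ↥(W.divisionField 3) := NumberField.mk
      ∀ κE : ZpExtension ↥Kp 3, κE.IsCyclotomic →
      haveI : FiniteDimensional ↥Kp (κE.layer 1) := κE.finiteDimensional_layer_holds 1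
      (unitsE (κE.layer 1) ⊓ (⊤ : Subgroup (κE.layer 1)ˣ).map (Herbrand.norm (κE.layer 1 ≃ₐ[↥Kp] κE.layer 1))).relIndex
        (unitsE (κE.layer 1) ⊓ (unitsIncl ↥Kp (κE.layer 1)).range) * 3 = 3 ^ 2) :
    MissingUpperBoundAt W 3 := by
  subst hWeq
  haveI : Fact (Nat.Prime 3) := ⟨Nat.prime_three⟩
  exact UnitIndexMuDoors.missingUpperBoundAt_three_of_hasSplitCartanNormalizerModPImage_of_realUnitIndex _ hKatoA hGZK hmod CoatesSujatha2005.thm34_fineSelmerDual_moduleFinite_of_classicalMuVanishes_divisionField_holds hFW fukuda1994_thm1_classNumberPExp_const_of_succ_eq_holds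
    hr classO6_g483678bi1_3 irr_g483678bi1_3 hasSplitCartanNormalizerModPImage_g483678bi1_3 hc Kp hKp hh hs hram hidx

/-! ### `272214x1` @ `p = 3` (`3Ns`; `K⁺ = ℚ[x]/(x⁴ − x³ − 44x² − 111x − 33)`, `h = 3` (unit door shut), `e₀ = e₁ = 1`: PASS FUKUDA (0,1), GRH at layer 1) -/

set_option synthInstance.maxHeartbeats 400000 in
set_option maxHeartbeats 4000000 in
/-- **[NoF re-issue: the named facts `hLim`/`hF1`/`hF2`/`hCS` displayed by the original are DISCHARGED here by the tree theorems `…_holds` — read «modulo hLim/hF1/hF2/hCS» below as «no longer assumed».]** **(A) AT `(272214x1, 3)` with `hμ` DISCHARGED by FUKUDA (0,1)** (modulo `hCS`, `hFW`, Fukuda Thm. 1 (1) `hF1`): `c` a complex conjugation,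
`Kp = ℚ(E[3])^c` (`≅ ℚ[x]/(x⁴−x³−44x²−111x−33)`, `h = 3`), displayed numerics: Fukuda index `0` (`hram`, PARI-exact) and `ord₃ h(Kp₁) = ord₃ h(Kp) = 1`
(`hord`; `Kp₁ = Kp·ℚ(ζ₉)⁺` of degree `12`, `h = 12` under GRH — kit j308542). KERNEL: the `3Ns` image (g18). CONDITIONAL; nothing booked.
[cite: Fukuda1994, Thm. 1 (1), p. 264] [cite: CoatesSujatha2005, Thm. 3.4 (§3)] [cite: Cremona2006, Table 1 (Cremona label 272214x1)] -/
theorem conjA_g272214x1_3_fkNoF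
    (hFW : ferreroWashington1979_classicalMuVanishes)
    {W : WeierstrassCurve ℚ} [W.IsElliptic] (hWeq : W = (⟨1, (-1), 1, (-33218615), (-74585302577)⟩ : WeierstrassCurve ℚ))
    {c : absoluteGaloisGroup ℚ} (hc : IsComplexConjugation (Rat.castHom ℝ) c)
    (Kp : IntermediateField ℚ ↥(W.divisionField 3)) (hKp : Kp = fixedField (Subgroup.zpowers (absRestrictNormalHom (W.divisionField 3) c)))
    (hram : ∀ κE : ZpExtension ↥Kp 3, κE.IsCyclotomic → TotallyRamifiedFrom κE 0)
    (hord : ∀ κE : ZpExtension ↥Kp 3, κE.IsCyclotomic → classNumberPExp κE (0 + 1) = classNumberPExp κE 0)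
    (κ : ZpExtension ℚ 3) (hκ : κ.IsCyclotomic) :
    ∃ (γ : absoluteGaloisGroup ℚ) (Df : W.FineSelmerDualData κ γ),
      Module.Finite ℤ_[3] (RestrictScalars ℤ_[3] (IwasawaAlgebra 3) Df.X) := by
  subst hWeq
  exact UnitIndexMuDoors.conjA_three_of_hasSplitCartanNormalizerModPImage_of_realSuccEq _ CoatesSujatha2005.thm34_fineSelmerDual_moduleFinite_of_classicalMuVanishes_divisionField_holds hFW fukuda1994_thm1_classNumberPExp_const_of_succ_eq_holds
    hasSplitCartanNormalizerModPImage_g272214x1_3 hc Kp hKp hram hord κ hκ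

set_option synthInstance.maxHeartbeats 400000 in
set_option maxHeartbeats 4000000 in
/-- **[NoF re-issue: the named facts `hLim`/`hF1`/`hF2`/`hCS` displayed by the original are DISCHARGED here by the tree theorems `…_holds` — read «modulo hLim/hF1/hF2/hCS» below as «no longer assumed».]** **RECORD — U₀ for `E = 272214x1` with `hμ` DISCHARGED by FUKUDA (0,1)**: named facts {A161-fine, GZK, modularity, `hCS`, `hFW`, `hF1`},
Cremona's `r_an = 0` (`hr`), and the displayed numerics `hram` (exact) / `hord` (`e₀ = e₁ = 1`, GRH at layer 1) of `Kp = ℚ(E[3])^c`. KERNEL (g18):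
elliptic, minimal, `ClassO6`, irreducible, `3Ns` image. Supersedes the displayed-`hμ` record `missingUpperBoundAt_g272214x1_3`. Per row; nothing
booked; BSD proved for no curve. [cite: Kato2004Asterisque, Thm. 14.5 (3) (p. 236)] [cite: Fukuda1994, Thm. 1 (1), p. 264]
[cite: Cremona2006, Table 1 (Cremona label 272214x1)] -/
theorem missingUpperBoundAt_g272214x1_3_fkNoF
    (hKatoA : Kato2004.rankZero_padicValNat_sha_add_padicValNat_tamagawa_le_of_additive_potGood_of_irreducible_of_fineSelmerDual_fg)
    (hGZK : rank_eq_analyticRank_of_analyticRank_le_one) (hmod : hasEntireLFunction_rat)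
    (hFW : ferreroWashington1979_classicalMuVanishes)
    {W : WeierstrassCurve ℚ} [W.IsElliptic] [W.IsGloballyMinimal] (hWeq : W = (⟨1, (-1), 1, (-33218615), (-74585302577)⟩ : WeierstrassCurve ℚ)) (hr : W.analyticRank = 0)
    {c : absoluteGaloisGroup ℚ} (hc : IsComplexConjugation (Rat.castHom ℝ) c)
    (Kp : IntermediateField ℚ ↥(W.divisionField 3)) (hKp : Kp = fixedField (Subgroup.zpowers (absRestrictNormalHom (W.divisionField 3) c)))
    (hram : ∀ κE : ZpExtension ↥Kp 3, κE.IsCyclotomic → TotallyRamifiedFrom κE 0)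
    (hord : ∀ κE : ZpExtension ↥Kp 3, κE.IsCyclotomic → classNumberPExp κE (0 + 1) = classNumberPExp κE 0) :
    MissingUpperBoundAt W 3 := by
  subst hWeq
  haveI : Fact (Nat.Prime 3) := ⟨Nat.prime_three⟩
  exact UnitIndexMuDoors.missingUpperBoundAt_three_of_hasSplitCartanNormalizerModPImage_of_realSuccEq _ hKatoA hGZK hmod CoatesSujatha2005.thm34_fineSelmerDual_moduleFinite_of_classicalMuVanishes_divisionField_holds hFW fukuda1994_thm1_classNumberPExp_const_of_succ_eq_holds
    hr classO6_g272214x1_3 irr_g272214x1_3 hasSplitCartanNormalizerModPImage_g272214x1_3 hc Kp hKp hram hord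

/-! ### `388800ii1` @ `p = 3` (`GL₂(𝔽₃)` image, 9-deficient; NO Cartan road) — on `L_P = ℚ(E[3])^{U_P} = ℚ(P, ζ₃)`
(`ℚ(P) ≅ ℚ[x]/(x⁸ − 24x⁴ − 56x² − 48)`, `L_P ≅ ℚ[x]/(x¹⁶ − 8x¹⁵ + 36x¹⁴ − 112x¹³ + 290x¹² − 504x¹¹ + 240x¹⁰ + 1368x⁹ − 2757x⁸ + 136x⁷ + 5536x⁶ − 1464x⁵ − 6918x⁴
+ 3120x³ + 10956x² + 5416x + 793)`, disc `2²⁴·3²⁴·5⁸`; `h = 2` CERT, primes `[2,2],[6,2]`, symbol rank `1`): PASS UNIT `s = 2` -/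

/-- **[NoF re-issue: the named facts `hLim`/`hF1`/`hF2`/`hCS` displayed by the original are DISCHARGED here by the tree theorems `…_holds` — read «modulo hLim/hF1/hF2/hCS» below as «no longer assumed».]** **(A) AT `(388800ii1, 3)` FROM THE UNIT NORM-INDEX door on `L_P = ℚ(E[3])^{U_P}`** (modulo the named facts Lim 2017 Thm. 3.5 `hLim` and
Fukuda Thm. 1 (1) `hF1`): for a `3`-torsion point `P` (the numerics are those of `P ≠ 0`: `L_P = ℚ(P, ζ₃)`, degree `16`), displayed PARI-certified
numerics of `L_P`: `3 ∤ h(L_P) = 2` (`hh`, bnfcertify at degree 16), two primes above `3` (`hs`), Fukuda index `0` (`hram`, exact `rnfdisc` test),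
first-layer unit norm index `3` (`hidx`, symbol rank `1`). No image hypothesis. The first (A)-certificate on this row free of GRH (conjA-anchor g9
j296187: FUKUDA1-LP(0,1) under GRH). CONDITIONAL; nothing booked; (A)/BSD proved for no curve.
[cite: Lim2017FineSelmer, §3 Thm. 3.5 and Lemma 3.2 (arXiv:1306.2047 pp. 6–7)] [cite: Lang1990, Ch. 13 §4, Lemma 4.1 (PDF p. 203)]
[cite: Cremona2006, Table 1 (Cremona label 388800ii1)] -/
theorem conjA_g388800ii1_3_lpNoF
    {W : WeierstrassCurve ℚ} [W.IsElliptic] (hWeq : W = (⟨0, 0, 0, (-13500), 603750⟩ : WeierstrassCurve ℚ)) (P : W.geomTorsion (3 : ℕ))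
    (hh : haveI := UnitIndexMuDoors.numberField_unipotentStabilizerField W 3 P
      ¬ 3 ∣ NumberField.classNumber ↥(W.unipotentStabilizerField 3 P))
    (hs : {v : HeightOneSpectrum (𝓞 ↥(W.unipotentStabilizerField 3 P)) | ((3 : ℕ) : 𝓞 ↥(W.unipotentStabilizerField 3 P)) ∈ v.asIdeal}.ncard = 2)
    (hram : ∀ κ : ZpExtension ↥(W.unipotentStabilizerField 3 P) 3, κ.IsCyclotomic → TotallyRamifiedFrom κ 0)
    (hidx : haveI := UnitIndexMuDoors.numberField_unipotentStabilizerField W 3 P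
      ∀ κ : ZpExtension ↥(W.unipotentStabilizerField 3 P) 3, κ.IsCyclotomic →
      haveI : FiniteDimensional ↥(W.unipotentStabilizerField 3 P) (κ.layer 1) := κ.finiteDimensional_layer_holds 1
      (unitsE (κ.layer 1) ⊓ (⊤ : Subgroup (κ.layer 1)ˣ).map (Herbrand.norm (κ.layer 1 ≃ₐ[↥(W.unipotentStabilizerField 3 P)] κ.layer 1))).relIndex
        (unitsE (κ.layer 1) ⊓ (unitsIncl ↥(W.unipotentStabilizerField 3 P) (κ.layer 1)).range) * 3 = 3 ^ 2)
    (κ : ZpExtension ℚ 3) (hκ : κ.IsCyclotomic) :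
    ∃ (γ : absoluteGaloisGroup ℚ) (Df : W.FineSelmerDualData κ γ),
      Module.Finite ℤ_[3] (RestrictScalars ℤ_[3] (IwasawaAlgebra 3) Df.X) := by
  subst hWeq
  haveI : Fact (Nat.Prime 3) := ⟨Nat.prime_three⟩
  exact UnitIndexMuDoors.fineSelmerDual_moduleFinite_of_relIndex_mul_eq_unipotentStabilizerField fukuda1994_thm1_classNumberPExp_const_of_succ_eq_holds Lim2017.thm35_fineSelmerDual_moduleFinite_of_classicalMuVanishes_of_le_divisionField_holds _ 3 (by decide) P hh hs hram hidx κ hκ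

/-- **[NoF re-issue: the named facts `hLim`/`hF1`/`hF2`/`hCS` displayed by the original are DISCHARGED here by the tree theorems `…_holds` — read «modulo hLim/hF1/hF2/hCS» below as «no longer assumed».]** **RECORD — U₀ `ord₃ #Ш(E) ≤ ord₃ #Ш_an(E)` for `E = 388800ii1` (a `GL₂(𝔽₃)`-image RESIDUE row of K9 items 19189 / 19197, hitherto WITHOUT any U₀
record) FROM THE UNIT NORM-INDEX door on `L_P`**: named facts {A161-fine `hKatoA`, GZK `hGZK`, modularity `hmod`, Lim 2017 Thm. 3.5 `hLim`, Fukuda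
`hF1`}, Cremona's `r_an = 0` (`hr`), a `3`-torsion point `P` and the PARI-certified numerics `hh`/`hs`/`hram`/`hidx` of `L_P = ℚ(E[3])^{U_P}`
(kit j308542: degree 16, `h = 2` CERT, `s = 2`, exact total ramification, symbol rank `1`). KERNEL (g18 Rows06): `E` elliptic, minimal,
`ClassO6 E 3`, `E[3]` irreducible. Per row; nothing booked; BSD proved for no curve. [cite: Kato2004Asterisque, Thm. 14.5 (3) (p. 236)]
[cite: Lim2017FineSelmer, §3 Thm. 3.5 and Lemma 3.2 (arXiv:1306.2047 pp. 6–7)] [cite: Lang1990, Ch. 13 §4, Lemma 4.1 (PDF p. 203)]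
[cite: Cremona2006, Table 1 (Cremona label 388800ii1)] -/
theorem missingUpperBoundAt_g388800ii1_3_lpNoF
    (hKatoA : Kato2004.rankZero_padicValNat_sha_add_padicValNat_tamagawa_le_of_additive_potGood_of_irreducible_of_fineSelmerDual_fg)
    (hGZK : rank_eq_analyticRank_of_analyticRank_le_one) (hmod : hasEntireLFunction_rat)
    {W : WeierstrassCurve ℚ} [W.IsElliptic] [W.IsGloballyMinimal] (hWeq : W = (⟨0, 0, 0, (-13500), 603750⟩ : WeierstrassCurve ℚ)) (hr : W.analyticRank = 0) (P : W.geomTorsion (3 : ℕ))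
    (hh : haveI := UnitIndexMuDoors.numberField_unipotentStabilizerField W 3 P
      ¬ 3 ∣ NumberField.classNumber ↥(W.unipotentStabilizerField 3 P))
    (hs : {v : HeightOneSpectrum (𝓞 ↥(W.unipotentStabilizerField 3 P)) | ((3 : ℕ) : 𝓞 ↥(W.unipotentStabilizerField 3 P)) ∈ v.asIdeal}.ncard = 2)
    (hram : ∀ κ : ZpExtension ↥(W.unipotentStabilizerField 3 P) 3, κ.IsCyclotomic → TotallyRamifiedFrom κ 0)
    (hidx : haveI := UnitIndexMuDoors.numberField_unipotentStabilizerField W 3 P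
      ∀ κ : ZpExtension ↥(W.unipotentStabilizerField 3 P) 3, κ.IsCyclotomic →
      haveI : FiniteDimensional ↥(W.unipotentStabilizerField 3 P) (κ.layer 1) := κ.finiteDimensional_layer_holds 1
      (unitsE (κ.layer 1) ⊓ (⊤ : Subgroup (κ.layer 1)ˣ).map (Herbrand.norm (κ.layer 1 ≃ₐ[↥(W.unipotentStabilizerField 3 P)] κ.layer 1))).relIndex
        (unitsE (κ.layer 1) ⊓ (unitsIncl ↥(W.unipotentStabilizerField 3 P) (κ.layer 1)).range) * 3 = 3 ^ 2) :
    MissingUpperBoundAt W 3 := by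
  subst hWeq
  haveI : Fact (Nat.Prime 3) := ⟨Nat.prime_three⟩
  exact UnitIndexMuDoors.missingUpperBoundAt_three_of_relIndex_mul_eq_unipotentStabilizerField _ hKatoA hGZK hmod Lim2017.thm35_fineSelmerDual_moduleFinite_of_classicalMuVanishes_of_le_divisionField_holds fukuda1994_thm1_classNumberPExp_const_of_succ_eq_holds
    hr classO6_g388800ii1_3 irr_g388800ii1_3 P hh hs hram hidx

end Summit.BirchSwinnertonDyer.BirchSwinnertonDyer.Theorems.WildUpperUnitTwistRecords

end
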